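import Summits.ResolutionOfSingularities.ResolutionOfSingularities.Theorems.WildQuotientsSummitReductionStubPairOrbitBlowupCentreNewLemmas
import Summits.ResolutionOfSingularities.ResolutionOfSingularities.Theorems.WildQuotientsSummitReductionStubPairOrbitBlowupCentreNewLemmas2
import Summits.ResolutionOfSingularities.ResolutionOfSingularities.Theorems.WildQuotientsSummitReductionStubPairOrbitBlowupCentreNewOrbitLemmas
import Literature.AlgebraicGeometry.Resolution.AlterationsSemiStableCodimTwoBlowupFormal
import Mathlib.RingTheory.Flat.FaithfullyFlat.Algebra
import HarnessLib

/-!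
# `WildQuotients.SummitReduction` (stmt-ResolutionOfSingularities-16324), line `FramePerfect`, skeleton v8:
# helper lemmas for stub `stub_pair_orbitBlowupCentreNew` (C3) — the residue field of the new
# codimension-2 singular point (de Jong 1996, 3.4, chart "`t₁ ≠ 0`", any field)

Route `ResolutionOfSingularities/WildQuotients`, crux `SummitReduction`; worker file supporting the
registered stub `stub_pair_orbitBlowupCentreNew` of the line skeleton (v8, lead c4).

Companion of `…CentreNewTransfer.lean` ("completion and blowing up commute", de Jong 1996, 3.4,
p. 64). Over an algebraically closed field all closed points are rational and the formal model at a
point of the blown-up curve `X₁` is read on constants from `k`; over an arbitrary field one needs to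
know that the singular point of the exceptional conic over the generic point `x_g` of a translate of
the centre is RATIONAL over `κ(x_g)`: in the chart "`t₁ ≠ 0`",
`A[u, v, u', v']/(u - t₁u', v - t₁v', u'v' - t₁^{n₁-2} ⋯)`, it is the point `u' = v' = t₁ = 0`.
Formally (`centreNew_transfer_residue`): in the situation of `centreNew_transfer` at a point `z`
whose completed centre `(u, v, T_{i₀})` is the MAXIMAL ideal of the model `M` (the case `z = x_g`),
every germ at a codimension-`≤ 2` singular point `x₁` of `X₁` over `Z` with `π x₁ ⤳ z` is a germ at
`z` plus an element of `𝔪_{x₁}`. Proof: lift `x₁` to the base change `P = X₁ ×_X Spec M`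
(`centreNew_transfer`'s setting); there the germ is `ρ^*(a)/ρ^*(s)` modulo `𝔪` with `a, s ∈ M`,
`s ∉ 𝔭 = 𝔪_M` a unit (`centreNew_blowup_triplePrime_residue`); `a/s ∈ M = 𝒪̂_{X,z}` is a germ at `z`
modulo `𝔪̂` (density), `ρ^*(𝔪_M) ⊆ 𝔪_y`, and `ρ^* ∘ (𝒪_{X,z} → M)` is the map through `X₁`
(`centreNew_pullback_stalk_square`: the pullback square read on stalks).
-/

set_option linter.dupNamespace false

noncomputable section

open CategoryTheory CategoryTheory.Limits AlgebraicGeometry TopologicalSpace Topology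
open Literature.AlgebraicGeometry.Resolution
open Literature.AlgebraicGeometry
open IsLocalRing Scheme.IdealSheafData DeJong1996.FormalNodeRing

namespace Summit.ResolutionOfSingularities.ResolutionOfSingularities.Theorems

universe u

/-! ## Germs of global functions on `Spec R` -/

/-- On `Spec R`, the germ at `w` of a global function `t ∈ w` (as a prime ideal) is not a unit:
under `𝒪_{Spec R, w} ≅ R_w` it is `t/1` (`Spec.germ_stalkMapIso_hom`). [folklore] -/
theorem centreNew_germ_mem_maximalIdeal_of_mem {R : CommRingCat.{u}} (w : Spec R) {t : R}
    (ht : t ∈ w.asIdeal) :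
    ((Spec R).presheaf.germ ⊤ w trivial).hom ((Scheme.ΓSpecIso R).inv.hom t) ∈
      maximalIdeal ((Spec R).presheaf.stalk w) := by
  have h0 : (Scheme.ΓSpecIso R).inv ≫ (Spec R).presheaf.germ ⊤ w trivial ≫ (Spec.stalkIso R w).hom =
      CommRingCat.ofHom (algebraMap R (Localization.AtPrime w.asIdeal)) := by
    rw [Spec.germ_stalkMapIso_hom, Iso.inv_hom_id_assoc]
  have h1 := congrArg (fun f => f.hom t) h0
  simp only [CommRingCat.hom_comp, RingHom.comp_apply, CommRingCat.hom_ofHom] at h1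
  rw [IsLocalRing.mem_maximalIdeal, mem_nonunits_iff]
  intro hu
  have h2 := hu.map (Spec.stalkIso R w).hom.hom
  rw [h1, IsLocalization.AtPrime.isUnit_to_map_iff (Localization.AtPrime w.asIdeal) w.asIdeal t] at h2
  exact h2 ht

/-! ## The pullback square `X₁ ×_X Spec M` read on stalks -/

/-- Along `ι : Spec M → Spec 𝒪_{X,z} → X` (for a ring map `c : 𝒪_{X,z} → M`), the composite
`𝒪_{X,z} → 𝒪_{X,ι w} → 𝒪_{Spec M,w}` is `𝒪_{X,z} → M = Γ(Spec M) → 𝒪_{Spec M,w}` (Stacks 01J7).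
[cite: StacksProject, Tag 01J7] -/
theorem centreNew_stalkSpecializes_stalkMap_SpecMap_fromSpecStalk {X : Scheme.{u}} (z : X)
    {M : CommRingCat.{u}} (c : X.presheaf.stalk z ⟶ M) (w : Spec M)
    (h : (Spec.map c ≫ X.fromSpecStalk z).base w ⤳ z) :
    X.presheaf.stalkSpecializes h ≫ (Spec.map c ≫ X.fromSpecStalk z).stalkMap w =
      c ≫ (Scheme.ΓSpecIso M).inv ≫ (Spec M).presheaf.germ ⊤ w trivial := by
  have e2 := centreNew_stalkSpecializes_stalkMap_fromSpecStalk z ((Spec.map c).base w) h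
  have e3 := Scheme.Hom.germ_stalkMap (Spec.map c) ⊤ w trivial
  have e4 := Scheme.ΓSpecIso_inv_naturality c
  calc X.presheaf.stalkSpecializes h ≫ (Spec.map c ≫ X.fromSpecStalk z).stalkMap w
      = X.presheaf.stalkSpecializes h ≫ (X.fromSpecStalk z).stalkMap ((Spec.map c).base w) ≫
          (Spec.map c).stalkMap w := by
        rw [Scheme.Hom.stalkMap_comp]
        rfl
    _ = ((Scheme.ΓSpecIso _).inv ≫
          (Spec (X.presheaf.stalk z)).presheaf.germ ⊤ ((Spec.map c).base w) trivial) ≫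
            (Spec.map c).stalkMap w := by
        rw [← e2]
        exact (Category.assoc _ _ _).symm
    _ = (Scheme.ΓSpecIso _).inv ≫ ((Spec.map c).app ⊤ ≫
          (Spec M).presheaf.germ ((Spec.map c) ⁻¹ᵁ ⊤) w trivial) := by
        rw [← e3]
        exact Category.assoc _ _ _
    _ = (c ≫ (Scheme.ΓSpecIso M).inv) ≫ (Spec M).presheaf.germ ⊤ w trivial := by
        rw [e4]
        exact (Category.assoc _ _ _).symm
    _ = c ≫ (Scheme.ΓSpecIso M).inv ≫ (Spec M).presheaf.germ ⊤ w trivial := Category.assoc _ _ _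

/-- **The base-change square on stalks.** For `π : X₁ ⟶ X`, a point `z`, a ring map
`c : 𝒪_{X,z} → M`, `ι : Spec M → Spec 𝒪_{X,z} → X` and a point `y` of `P = X₁ ×_X Spec M` with
`π (pr₁ y) ⤳ z`: the composite `𝒪_{X,z} → 𝒪_{X,π(pr₁ y)} → 𝒪_{X₁,pr₁ y} → 𝒪_{P,y}` is
`𝒪_{X,z} → M = Γ(Spec M) → Γ(P) → 𝒪_{P,y}` (pull back global functions along `pr₂` and take germs).
[folklore] -/
theorem centreNew_pullback_stalk_square {X X₁ : Scheme.{u}} (π : X₁ ⟶ X) (z : X) {M : CommRingCat.{u}}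
    (c : X.presheaf.stalk z ⟶ M) (y : ↥(pullback π (Spec.map c ≫ X.fromSpecStalk z)))
    (hsp : π.base ((pullback.fst π (Spec.map c ≫ X.fromSpecStalk z)).base y) ⤳ z) :
    X.presheaf.stalkSpecializes hsp ≫ π.stalkMap _ ≫
        (pullback.fst π (Spec.map c ≫ X.fromSpecStalk z)).stalkMap y =
      c ≫ (Scheme.ΓSpecIso M).inv ≫ (pullback.snd π (Spec.map c ≫ X.fromSpecStalk z)).appTop ≫
        (pullback π (Spec.map c ≫ X.fromSpecStalk z)).presheaf.germ ⊤ y trivial := by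
  have h₂ : (Spec.map c ≫ X.fromSpecStalk z).base
      ((pullback.snd π (Spec.map c ≫ X.fromSpecStalk z)).base y) ⤳ z := by
    have h : (Spec.map c ≫ X.fromSpecStalk z).base
        ((pullback.snd π (Spec.map c ≫ X.fromSpecStalk z)).base y) =
        π.base ((pullback.fst π (Spec.map c ≫ X.fromSpecStalk z)).base y) := by
      change (pullback.snd π _ ≫ Spec.map c ≫ X.fromSpecStalk z).base y = (pullback.fst π _ ≫ π).base y
      rw [pullback.condition]
    rw [h]
    exact hsp
  have hι := centreNew_stalkSpecializes_stalkMap_SpecMap_fromSpecStalk z c _ h₂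
  rw [centreNew_stalkSpecializes_comp_stalkMap_eq _ π _ _ pullback.condition y hsp h₂,
    reassoc_of% hι]
  erw [Scheme.Hom.germ_stalkMap (pullback.snd π (Spec.map c ≫ X.fromSpecStalk z)) ⊤ y trivial]
  rfl

/-! ## The residue field of the new singular point -/

set_option maxHeartbeats 3200000 in
/-- **The new codimension-2 singular point is rational over the old one** (de Jong 1996, 3.4, chart
"`t₁ ≠ 0`": "The "new" component `T̃` lying over `T` is given by `u' = v' = t₁ = 0`", read over an
arbitrary field). In the situation of `centreNew_transfer` — `π : X₁ ⟶ X` a blow-up of the Noetherian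
`X` in the ideal sheaf of the closed `Z`, `z ∈ X` with formal coordinates
`e : 𝒪̂_{X,z} ≅ M = K⟦u, v, T⟧/(uv - ∏ Tᵢ^{νᵢ})`, `x' ⤳ z` with `I(Z)_z = 𝔭_{x'}` completing to
`(u, v, T_{i₀})`, `ν_{i₀} ≥ 2` — assume moreover that `(u, v, T_{i₀})` is the maximal ideal of `M`
(every element outside it is a unit; the case `m = 1`, `z = x'` of codimension `2`). Then at every
codimension-`≤ 2` singular point `x₁` of `X₁` over `Z` with `π x₁ ⤳ z`, every germ is a germ at `z`
plus an element of `𝔪_{x₁}`: `κ(z) → κ(x₁)` is onto. Proof: lift `x₁` to `y ∈ P = X₁ ×_X Spec M`;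
the germ pushed to `𝒪_{P,y}` is `ρ^*(a)/ρ^*(s)` modulo `𝔪_y` with `a, s ∈ M`, `s` a unit
(`centreNew_blowup_triplePrime_residue`); `a/s` is a germ `o` at `z` modulo `𝔪_M` (density of
`𝒪_{X,z}` in `M`), `ρ^*(𝔪_M) ⊆ 𝔪_y` (`centreNew_germ_mem_maximalIdeal_of_mem`), and
`ρ^*` of a germ at `z` is its image through `X₁` (`centreNew_pullback_stalk_square`); finally
`𝒪_{X₁,x₁} → 𝒪_{P,y}` is local. [cite: DeJong1996, 3.4 Claim (iii), p. 64] -/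
theorem centreNew_transfer_residue {X X₁ : Scheme.{u}} [IsNoetherian X] {π : X₁ ⟶ X} {Z : Set X}
    (hZ : IsClosed Z) (hπ : IsBlowup π (vanishingIdeal ⟨Z, hZ⟩)) {z x' : X} (hx'z : x' ⤳ z)
    {K : Type u} [Field K] {m : ℕ} {ν : Fin m → ℕ} {i₀ : Fin m} (hν : 2 ≤ ν i₀)
    (e : AdicCompletion (maximalIdeal (X.presheaf.stalk z)) (X.presheaf.stalk z) ≃+*
      DeJong1996.FormalNodeRing K m ν)
    (hJ : stalkIdeal (vanishingIdeal ⟨Z, hZ⟩) z = primeOfSpecializes hx'z)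
    (hP : ((primeOfSpecializes hx'z).map (algebraMap (X.presheaf.stalk z)
        (AdicCompletion (maximalIdeal (X.presheaf.stalk z)) (X.presheaf.stalk z)))).map e.toRingHom =
      triplePrime K m ν i₀)
    (hmax : ∀ s : DeJong1996.FormalNodeRing K m ν, s ∉ triplePrime K m ν i₀ → IsUnit s) :
    ∀ x₁ ∈ Scheme.singularLocusCodimLE X₁ 2, π.base x₁ ∈ Z → ∀ (hsp : π.base x₁ ⤳ z),
      ∀ r : X₁.presheaf.stalk x₁, ∃ o : X.presheaf.stalk z,
        r - (π.stalkMap x₁).hom ((X.presheaf.stalkSpecializes hsp).hom o) ∈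
          maximalIdeal (X₁.presheaf.stalk x₁) := by
  classical
  haveI : IsProper π := hπ.isProper
  haveI : IsLocallyNoetherian X₁ := LocallyOfFiniteType.isLocallyNoetherian π
  set T : Closeds X := ⟨Z, hZ⟩ with hT
  -- the flat local ring map `c : 𝒪_{X,z} → 𝒪̂_{X,z} ≅ M`
  let O : CommRingCat.{u} := X.presheaf.stalk z
  let Ô := AdicCompletion (maximalIdeal O) O
  let M := DeJong1996.FormalNodeRing K m ν
  haveI : IsNoetherianRing (MvPowerSeries (Fin 2 ⊕ Fin m) K) :=
    isNoetherianRing_mvPowerSeries K (Fin 2 ⊕ Fin m)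
  haveI : IsNoetherianRing M := inferInstanceAs (IsNoetherianRing (_ ⧸ _))
  haveI : Nontrivial M := e.injective.nontrivial
  haveI : IsLocalRing M := IsLocalRing.of_surjective' (e : Ô →+* M) e.surjective
  haveI hp : (triplePrime K m ν i₀).IsPrime := isPrime_triplePrime K hν
  let c : O ⟶ CommRingCat.of M := CommRingCat.ofHom ((e : Ô →+* M).comp (algebraMap O Ô))
  have hc : c.hom = (e : Ô →+* M).comp (algebraMap O Ô) := rfl
  have hcflat : c.hom.Flat := by
    rw [hc]
    exact RingHom.Flat.comp (RingHom.flat_algebraMap_iff.mpr (AdicCompletion.flat_of_isNoetherian _))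
      (RingHom.Flat.of_bijective e.bijective)
  haveI : IsLocalHom c.hom := by
    rw [hc]
    infer_instance
  have hPc : (primeOfSpecializes hx'z).map c.hom = triplePrime K m ν i₀ := by
    rw [hc, ← Ideal.map_map]
    exact hP
  have hcentre' : (stalkIdeal (vanishingIdeal T) z).map c.hom = triplePrime K m ν i₀ := by
    rw [hT, hJ]
    exact hPc
  -- the flat morphism `ι : Spec M → X` and the base-changed blow-up `ρ`
  let ι : Spec (.of M) ⟶ X := Spec.map c ≫ X.fromSpecStalk z
  haveI : Flat (Spec.map c) := Flat.SpecMap_iff.mpr hcflat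
  haveI : Flat (X.fromSpecStalk z) := flat_fromSpecStalk X z
  haveI : Flat ι := inferInstance
  let φ := pullback.fst π ι
  let ρ := pullback.snd π ι
  haveI : Flat φ := inferInstance
  haveI : IsLocallyNoetherian (pullback π ι) := LocallyOfFiniteType.isLocallyNoetherian ρ
  have hB : IsBlowup ρ (ofIdealTop ((triplePrime K m ν i₀).map (Scheme.ΓSpecIso (.of M)).inv.hom)) := by
    have h1 := hπ.pullback_snd_of_flat ι
    rwa [show ι = Spec.map c ≫ X.fromSpecStalk z from rfl,
      comap_SpecMap_comp_fromSpecStalk_eq_ofIdealTop, hcentre'] at h1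
  have Hres := centreNew_blowup_triplePrime_residue K m ν i₀ hν _ ρ hB
  -- `ι` hits every generization of `z`
  have hιsurj : ∀ w : X, w ⤳ z → ∃ q : Spec (.of M), ι.base q = w := by
    intro w hw
    obtain ⟨p, hp⟩ : w ∈ Set.range (X.fromSpecStalk z) := by
      rw [Scheme.range_fromSpecStalk]
      exact hw
    letI : Algebra O M := c.hom.toAlgebra
    haveI : Module.Flat O M := hcflat
    haveI : Module.FaithfullyFlat O M := Module.FaithfullyFlat.of_flat_of_isLocalHom
    obtain ⟨q, hq⟩ := PrimeSpectrum.comap_surjective_of_faithfullyFlat (A := O) (B := M) p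
    refine ⟨q, ?_⟩
    change X.fromSpecStalk z (Spec.map c q) = w
    rw [← hp]
    congr 1
  -- points of `Spec M` over `Z` are the points of `V(𝔭)`
  have hιT : ∀ q : Spec (.of M), ι.base q ∈ (T : Set X) ↔ triplePrime K m ν i₀ ≤ q.asIdeal := by
    intro q
    rw [show ι = Spec.map c ≫ X.fromSpecStalk z from rfl, ← hcentre']
    exact SpecMap_comp_fromSpecStalk_mem_iff z c T q
  -- the lift of a codimension-`≤ 2` singular point over `Z` specializing to `z`
  have lift : ∀ x₁ ∈ Scheme.singularLocusCodimLE X₁ 2, π.base x₁ ∈ Z → π.base x₁ ⤳ z →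
      ∃ y : ↥(pullback π ι), φ.base y = x₁ ∧ triplePrime K m ν i₀ ≤ (ρ.base y).asIdeal ∧
        ¬ IsRegularLocalRing ((pullback π ι).presheaf.stalk y) ∧
        ringKrullDim ((pullback π ι).presheaf.stalk y) ≤ 2 := by
    intro x₁ hx₁ hE hsp
    obtain ⟨q, hq⟩ := hιsurj (π.base x₁) hsp
    obtain ⟨y₀, hy₀, -⟩ := Scheme.Pullback.exists_preimage_pullback (f := π) (g := ι) x₁ q hq.symm
    obtain ⟨y, hy, hdim⟩ := exists_preimage_ringKrullDim_stalk_eq φ (x' := x₁) ⟨y₀, hy₀⟩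
    refine ⟨y, hy, ?_, ?_, ?_⟩
    · rw [← hιT, ← Scheme.Hom.comp_apply, ← pullback.condition, Scheme.Hom.comp_apply]
      change π.base (φ.base y) ∈ Z
      rw [hy]
      exact hE
    · refine not_isRegularLocalRing_stalk_of_flat φ y ?_
      rw [hy]
      exact hx₁.1
    · rw [hdim]
      exact hx₁.2
  -- ### the residue field at the lift
  intro x₁ hx₁ hE hsp r
  obtain ⟨y, hy, h1, h2, h3⟩ := lift x₁ hx₁ hE hsp
  subst hy
  obtain ⟨hρy, -, Hres3⟩ := Hres y h1 h2 h3
  -- `ρt : M → 𝒪_{P,y}`, pulling back global functions along `ρ`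
  let ρt : M →+* (pullback π ι).presheaf.stalk y :=
    ((pullback π ι).presheaf.germ ⊤ y trivial).hom.comp
      (ρ.appTop.hom.comp (Scheme.ΓSpecIso (.of M)).inv.hom)
  -- `ρt (𝔭) ⊆ 𝔪_y`
  have hρt_max : ∀ t ∈ triplePrime K m ν i₀, ρt t ∈ maximalIdeal _ := by
    intro t ht
    rw [← hρy] at ht
    have hg := centreNew_germ_mem_maximalIdeal_of_mem (ρ.base y) ht
    have h4 := map_nonunit (ρ.stalkMap y).hom _ hg
    have h0 := Scheme.Hom.germ_stalkMap ρ ⊤ y trivial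
    have h5 := congrArg (fun f => f.hom ((Scheme.ΓSpecIso (.of M)).inv.hom t)) h0
    simp only [CommRingCat.hom_comp, RingHom.comp_apply] at h5
    rw [h5] at h4
    exact h4
  -- the germ at `y`: `r · ρt s - ρt a ∈ 𝔪_y`, `s` a unit
  obtain ⟨a, s, hs, hc'⟩ := Hres3 ((φ.stalkMap y).hom r)
  have hc'' : (φ.stalkMap y).hom r * ρt s - ρt a ∈ maximalIdeal _ := hc'
  obtain ⟨u, hu⟩ := hmax s hs
  obtain ⟨p, hpdef⟩ : ∃ p : M, p = a * ↑u⁻¹ := ⟨_, rfl⟩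
  have hap : a = p * s := by rw [hpdef, ← hu, Units.inv_mul_cancel_right]
  have hstep1 : (φ.stalkMap y).hom r - ρt p ∈ maximalIdeal _ := by
    obtain ⟨us, hus⟩ := (hu ▸ Units.isUnit u : IsUnit s).map ρt
    have heq : (φ.stalkMap y).hom r - ρt p =
        ((φ.stalkMap y).hom r * ρt s - ρt a) * ↑us⁻¹ := by
      rw [hap, map_mul, ← hus, ← sub_mul, mul_assoc, Units.mul_inv, mul_one]
    rw [heq]
    exact Ideal.mul_mem_right _ _ hc''
  -- `p` is a germ at `z` modulo `𝔪_M`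
  obtain ⟨o, ho⟩ := NodalDeformation.exists_sub_algebraMap_mem_pow (A := (O : Type u)) (e.symm p) 1
  rw [pow_one] at ho
  have hpo : p - c.hom o ∈ triplePrime K m ν i₀ := by
    by_contra hnot
    have hu' := hmax _ hnot
    have h6 : p - c.hom o = e (e.symm p - algebraMap _ _ o) := by
      rw [map_sub, e.apply_symm_apply]
      rfl
    rw [h6] at hu'
    have hu'' : IsUnit (e.symm p - algebraMap _ _ o) := by
      have := hu'.map e.symm
      rwa [e.symm_apply_apply] at this
    exact (mem_nonunits_iff.mp ((IsLocalRing.mem_maximalIdeal _).mp ho)) hu''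
  have hstep2 : ρt (p - c.hom o) ∈ maximalIdeal _ := hρt_max _ hpo
  have hstep3 : (φ.stalkMap y).hom r - ρt (c.hom o) ∈ maximalIdeal _ := by
    have := Ideal.add_mem _ hstep1 hstep2
    rwa [map_sub, sub_add_sub_cancel] at this
  -- the square: `ρt (c o)` is the image of `o` through `X₁`
  have hsq := centreNew_pullback_stalk_square π z c y hsp
  have hsq' : (φ.stalkMap y).hom ((π.stalkMap (φ.base y)).hom ((X.presheaf.stalkSpecializes hsp).hom o)) =
      ρt (c.hom o) := by
    have h7 := congrArg (fun f => f.hom o) hsq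
    simp only [CommRingCat.hom_comp, RingHom.comp_apply] at h7
    exact h7
  refine ⟨o, ?_⟩
  have hloc : (φ.stalkMap y).hom (r - (π.stalkMap (φ.base y)).hom
      ((X.presheaf.stalkSpecializes hsp).hom o)) ∈ maximalIdeal _ := by
    rw [map_sub, hsq']
    exact hstep3
  exact (IsLocalRing.mem_maximalIdeal _).mpr (mem_nonunits_iff.mpr fun hunit =>
    (mem_nonunits_iff.mp ((IsLocalRing.mem_maximalIdeal _).mp hloc)) (hunit.map _))

end Summit.ResolutionOfSingularities.ResolutionOfSingularities.Theorems

end
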